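import Summits.Parity.GeneralizedHardyLittlewood.Theorems.LeeYangFibresFibrationLemmaXSum
import Summits.Parity.GeneralizedHardyLittlewood.Theorems.LeeYangFibresFibrationLemmaEqui
import HarnessLib

/-!
# Fibration lemma (`DimOne → GeneralizedHardyLittlewood`), part 9a: the setting for averaging the fibre main terms

Support file for the statement item `FibrationLemma : DimOne → GeneralizedHardyLittlewood`
(Green–Tao 2010, §1, remark after Conj. 1.2). This is the analytic heart of the fibration lemma:
for a system `Ψ` on `ℤ^{d+1}` with every `ψ̇ᵢ(e_{d+1}) ≠ 0`, positive on a convex `K ⊆ [-N,N]^{d+1}`,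
the fibre main terms `ℓ(w) 𝔖(Φ_w)` (`ℓ(w)` = length of the fibre `K_w`, `𝔖(Φ_w)` = singular product of
the fibre system) average to the main term of `Ψ`:

  `|∑_{w good} ℓ(w) ∏_{p≤x} β_p(Φ_w) - vol(K) ∏_{p≤x} β_p(Ψ)| ≤ avgError`   for all `x ≥ z`

(`abs_fibreMainSum_sub_le`, in part 9b `…AveragingEstimate`, with its limit form), where
`avgError` (`avgError`, defined here) is explicit in `N`, the truncation `z`, and the constants of
parts 7–8. This file sets up the standing data (`FibreSetting`), the fibre lengths `ℓ(w)`, lattice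
counts `c(w)` and heads `H(w)` with their basic properties (periodicity, equidistribution). The
proof in part 9b is the decomposition `∏_{p≤x} β_p(Φ_w) = H(w) · B · R(w)`, `∏_{p≤x} β_p(Ψ) = H̄ · B · R̄` (part 6):

  `∑ ℓ H B R - vol H̄ B R̄ = B · [∑ ℓ H (R - 1) + (∑_{good} ℓ H - vol H̄) + vol H̄ (1 - R̄)]`,

with `R - 1 ≤ X e^X` small in `L¹` (part 8), `∑_w ℓ(w) H(w) ≈ ∑_{n ∈ K ∩ ℤ^{d+1}} H(n') ≈ vol(K) H̄`
by the `Q`-periodicity of the head and equidistribution (part 5; `Q = ∏_{p≤z} p`, `β_Q = ∏_{p ≤ z} β_p`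
by multiplicativity, `β_Q(Ψ) = 𝔼_r β_Q(Φ_r)` by part 1), and `R̄ - 1 ≤ (2t³/z) e^{2t³/z}`.
The standing data and hypotheses are bundled in `FibreSetting`.
-/

noncomputable section

open Finset MeasureTheory Filter
open scoped Topology

namespace Summit.Parity.GeneralizedHardyLittlewood.Theorems

open Literature.NumberTheory.Sieve

variable {d t : ℕ}

/-! ### The standing setting -/

/-- The data and standing hypotheses of the fibre argument: a non-degenerate system `Ψ` of `t ≥ 1`
forms on `ℤ^{d+1}` (`d ≥ 1`) with coefficients `≤ L`, constants `≤ L N`, every last coefficient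
non-zero, and a convex body `K ⊆ [-N, N]^{d+1}` (`N ≥ 1`) on which every form is positive.
[cite: GreenTao2010, §1 (remark after Conj. 1.2)] -/
structure FibreSetting (d t : ℕ) where
  /-- the system -/
  Ψ : Fin t → AffLinForm (d + 1)
  /-- the coefficient bound -/
  L : ℕ
  /-- the scale -/
  N : ℕ
  /-- the convex body -/
  K : Set (Fin (d + 1) → ℝ)
  nondeg : IsNondegenerateSystem Ψ
  one_le_d : 1 ≤ d
  one_le_t : 1 ≤ t
  coeff_le : ∀ i j, ((Ψ i).coeff j).natAbs ≤ L
  const_le : ∀ i, (Ψ i).const.natAbs ≤ L * N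
  lastCoeff_ne : ∀ i, lastCoeff (Ψ i) ≠ 0
  one_le_N : 1 ≤ N
  convex : Convex ℝ K
  subset : K ⊆ realBox (d + 1) N
  pos : ∀ x ∈ K, ∀ i, 0 < (Ψ i).realEval x

namespace FibreSetting

variable (S : FibreSetting d t)

/-- `1 ≤ L`. [folklore] -/
theorem one_le_L : 1 ≤ S.L := one_le_of_coeff_bound S.coeff_le S.lastCoeff_ne S.one_le_t

/-- The fibre length `ℓ(w) = β_∞(Φ_w, K_w)`. [cite: GreenTao2010, (1.4)] -/
def ell (w : Fin d → ℤ) : ℝ :=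
  archFactor (fibreSystem S.Ψ w) (fibreBody S.K (realPoint w))

open Classical in
/-- The fibre lattice count `c(w) = #(K_w ∩ ℤ)`. [folklore] -/
def cnt (w : Fin d → ℤ) : ℕ :=
  #{m ∈ latticeBox 1 S.N | realPoint m ∈ fibreBody S.K (realPoint w)}

/-- The head `H(w) = ∏_{p ≤ z} β_p(Φ_w)`. [cite: GreenTao2010, (1.7)] -/
def head (z : ℕ) (w : Fin d → ℤ) : ℝ :=
  singularProductPartial (fibreSystem S.Ψ w) z

/-! ### The fibre lengths -/

/-- On a fibre body all fibre forms are positive, so `ℓ(w) = vol(K_w)`. [cite: GreenTao2010, (1.4)] -/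
theorem ell_eq_volume (w : Fin d → ℤ) : S.ell w = (volume (fibreBody S.K (realPoint w))).toReal := by
  unfold ell archFactor
  congr 2
  refine Set.inter_eq_left.mpr fun y hy i => ?_
  simp only [fibreSystem, fibreForm_realEval]
  have h := S.pos _ (mem_fibreBody.mp hy) i
  rw [realEval_snoc, baseForm_realEval_realPoint] at h
  exact h

/-- `0 ≤ ℓ(w)`. [folklore] -/
theorem ell_nonneg (w : Fin d → ℤ) : 0 ≤ S.ell w := by
  rw [ell_eq_volume]; exact ENNReal.toReal_nonneg

/-- `ℓ(w) ≤ 2N` (`K_w ⊆ [-N, N]`). [folklore] -/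
theorem ell_le (w : Fin d → ℤ) : S.ell w ≤ 2 * S.N := by
  rw [ell_eq_volume]
  have hsub := fibreBody_subset_realBox S.subset (realPoint w)
  have hvol : (volume (realBox 1 (S.N : ℝ))).toReal = 2 * S.N := by
    unfold realBox
    rw [Real.volume_Icc_pi_toReal (fun _ => by
      have : (0 : ℝ) ≤ S.N := Nat.cast_nonneg _
      linarith)]
    simp only [Finset.univ_unique, Fin.default_eq_zero, Finset.prod_singleton]
    ring
  rw [← hvol]
  exact ENNReal.toReal_mono (by unfold realBox; exact isCompact_Icc.measure_lt_top.ne)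
    (measure_mono hsub)

/-- `|ℓ(w) - c(w)| ≤ 1` (lattice points of an interval). [cite: GreenTao2010, App. A] -/
theorem abs_ell_sub_cnt_le (w : Fin d → ℤ) : |S.ell w - S.cnt w| ≤ 1 := by
  rw [ell_eq_volume, abs_sub_comm]
  have h := LatticePointsConvexBody.abs_card_sub_volume_le 0 S.one_le_N (fibreBody S.K (realPoint w))
    (convex_fibreBody S.convex _) (fibreBody_subset_realBox S.subset _)
  unfold cnt
  simpa using h

open Classical in
/-- `c(w)` as a count over `m ∈ [-N, N]`. [folklore] -/
theorem cnt_eq (w : Fin d → ℤ) :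
    (S.cnt w : ℝ) = #{m ∈ Icc (-(S.N : ℤ)) S.N | realPoint (Fin.snoc w m : Fin (d + 1) → ℤ) ∈ S.K} := by
  unfold cnt latticeBox
  rw [Finset.card_eq_sum_ones, Finset.card_eq_sum_ones, Finset.sum_filter, Finset.sum_filter]
  push_cast
  rw [sum_piFinset_const_fin_one]
  refine Finset.sum_congr rfl fun m _ => ?_
  simp only [mem_fibreBody, realPoint_snoc]
  rfl

open Classical in
/-- **Un-fibring a weighted count**: `∑_{n ∈ K ∩ ℤ^{d+1}} F(n') = ∑_w c(w) F(w)`. [folklore] -/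
theorem sum_filter_eq_sum_cnt_mul (F : (Fin d → ℤ) → ℝ) :
    ∑ n ∈ (latticeBox (d + 1) S.N).filter (fun n => realPoint n ∈ S.K), F (Fin.init n) =
      ∑ w ∈ latticeBox d S.N, (S.cnt w : ℝ) * F w := by
  rw [sum_filter_latticeBox_succ]
  refine Finset.sum_congr rfl fun w _ => ?_
  rw [cnt_eq, Finset.sum_congr rfl fun m _ => by rw [Fin.init_snoc], Finset.sum_const, nsmul_eq_mul]

/-! ### The heads: periodicity, size, equidistribution -/

/-- `H(w) = β_Q(Φ_w)` with `Q = ∏_{p ≤ z} p`. [cite: GreenTao2010, (1.6) and §5] -/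
theorem head_eq_localFactor (z : ℕ) (w : Fin d → ℤ) :
    S.head z w = localFactor (fibreSystem S.Ψ w) (primorial z) := by
  rw [head, localFactor_primorial]

/-- `H` is `Q`-periodic. [cite: GreenTao2010, (1.6)] -/
theorem head_periodic (z : ℕ) (w w' : Fin d → ℤ) (h : ∀ j, ((w j : ℤ) : ZMod (primorial z)) = w' j) :
    S.head z w = S.head z w' := by
  haveI : NeZero (primorial z) := ⟨(primorial_pos z).ne'⟩
  rw [head_eq_localFactor, head_eq_localFactor, localFactor_fibreSystem_congr S.Ψ h]

/-- `0 ≤ H(w) ≤ headMax` (`z ≥ 2`). [cite: GreenTao2010, proof of Lemma 1.3] -/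
theorem head_le {z : ℕ} (hz : 2 ≤ z) (w : Fin d → ℤ) : 0 ≤ S.head z w ∧ S.head z w ≤ headMax t z :=
  ⟨singularProductPartial_nonneg _ _, singularProductPartial_le_headMax _ hz⟩

/-- `|H(w)| ≤ headMax`. [folklore] -/
theorem abs_head_le {z : ℕ} (hz : 2 ≤ z) (w : Fin d → ℤ) : |S.head z w| ≤ headMax t z := by
  rw [abs_of_nonneg (S.head_le hz w).1]; exact (S.head_le hz w).2

/-- The average of the heads over the residues mod `Q` is the head of `Ψ`:
`Q^{-d} ∑_{r ∈ (ℤ/Q)^d} H(r) = ∏_{p ≤ z} β_p(Ψ)`. [cite: GreenTao2010, (1.6)] -/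
theorem avg_head_eq (z : ℕ) :
    (((primorial z : ℕ) : ℝ) ^ d)⁻¹ *
        ∑ r ∈ Fintype.piFinset (fun _ : Fin d => range (primorial z)), S.head z (fun j => (r j : ℤ)) =
      singularProductPartial S.Ψ z := by
  rw [← localFactor_primorial, localFactor_eq_avg_fibre S.Ψ (primorial_pos z).ne']
  congr 1
  refine Finset.sum_congr rfl fun r _ => ?_
  rw [head_eq_localFactor]

/-- **Equidistribution of the heads**: `|∑_w c(w) H(w) - vol(K) ∏_{p≤z} β_p(Ψ)| ≤ headMax Q^d (d+1)4^d (2N)^d`.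
[cite: GreenTao2010, App. A] -/
theorem abs_sum_cnt_head_sub_le {z : ℕ} (hz : 2 ≤ z) :
    |∑ w ∈ latticeBox d S.N, (S.cnt w : ℝ) * S.head z w -
        (volume S.K).toReal * singularProductPartial S.Ψ z| ≤
      headMax t z * ((primorial z : ℕ) : ℝ) ^ d * (((d : ℝ) + 1) * 4 ^ d * ((2 * S.N : ℕ) : ℝ) ^ d) := by
  rw [← S.sum_filter_eq_sum_cnt_mul, ← S.avg_head_eq z]
  exact abs_sum_periodic_sub_volume_mul_le (primorial z) (primorial_pos z) S.one_le_N S.convex S.subset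
    (S.head z) (S.head_periodic z) (S.abs_head_le hz)

end FibreSetting

/-! ### The error bound -/

/-- The explicit error of the averaging lemma:
`𝔅 · [2N · H_max · e^{X_max} · 𝒳 + H_max (t² (2N+1)^{d-1} 2N + (2N+1)^d + Q^d (d+1) 4^d (2N)^d)
      + (2N)^{d+1} H̄_max (2t³/z) e^{2t³/z}]`. [folklore] -/
def avgError (d t L N z : ℕ) : ℝ :=
  tailBound t (discMax d L N) *
    (2 * N * headMax t z * Real.exp (tailXmax t (discMax d L N) z) *
        (2 * (t : ℝ) ^ 3 * (2 * N + 1 : ℝ) ^ (d - 1) *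
          (2 * (discMax d L N : ℝ) / z + Real.log (Real.log (discMax d L N)) + 4)) +
      headMax t z * ((t * t * (2 * N + 1) ^ (d - 1) : ℕ) * (2 * N) + ((2 * N + 1) ^ d : ℕ) +
        ((primorial z : ℕ) : ℝ) ^ d * (((d : ℝ) + 1) * 4 ^ d * ((2 * N : ℕ) : ℝ) ^ d)) +
      (2 * (N : ℝ)) ^ (d + 1) * headBar t L (discMax d L N) *
        ((2 * (t : ℝ) ^ 3 / z) * Real.exp (2 * (t : ℝ) ^ 3 / z)))

/-- `|a + b - c| ≤ |a| + |b| + |c|`. [folklore] -/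
theorem abs_add_sub_le_three (a b c : ℝ) : |a + b - c| ≤ |a| + |b| + |c| :=
  calc |a + b - c| ≤ |a + b| + |c| := abs_sub _ _
    _ ≤ |a| + |b| + |c| := by gcongr; exact abs_add_le _ _

/-- `exp u - 1 ≤ u exp u`. [folklore] -/
theorem exp_sub_one_le_mul_exp (u : ℝ) : Real.exp u - 1 ≤ u * Real.exp u := by
  have h := Real.add_one_le_exp (-u)
  have he : 0 < Real.exp u := Real.exp_pos u
  have : (-u + 1) * Real.exp u ≤ Real.exp (-u) * Real.exp u := mul_le_mul_of_nonneg_right h he.le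
  rw [← Real.exp_add, neg_add_cancel, Real.exp_zero] at this
  nlinarith

namespace FibreSetting

variable (S : FibreSetting d t)

/-- A good base point exists once `2N + 1 > t²`. [folklore] -/
theorem goodSet_nonempty (hNt : t * t < 2 * S.N + 1) : (goodSet S.Ψ S.N).Nonempty := by
  classical
  by_contra h
  rw [Finset.not_nonempty_iff_eq_empty] at h
  have hsum := sum_latticeBox_eq_sum_goodSet_add_sum_badSet S.Ψ S.N (fun _ => (1 : ℕ))
  simp only [Finset.sum_const, smul_eq_mul, mul_one, h, Finset.card_empty, zero_add] at hsum
  have hbad := card_badSet_le S.nondeg S.lastCoeff_ne S.N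
  have hbox : #(latticeBox d S.N) = (2 * S.N + 1) ^ d := by
    have h1 : ((S.N : ℤ) + 1 - -(S.N : ℤ)) = ((2 * S.N + 1 : ℕ) : ℤ) := by push_cast; ring
    simp only [latticeBox, Fintype.card_piFinset, Int.card_Icc, Finset.prod_const, Finset.card_univ,
      Fintype.card_fin, h1, Int.toNat_natCast]
  rw [hbox] at hsum
  have hd := S.one_le_d
  have : (2 * S.N + 1) ^ d = (2 * S.N + 1) ^ (d - 1) * (2 * S.N + 1) := by
    rw [← pow_succ, Nat.sub_add_cancel hd]
  rw [this] at hsum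
  have hpos : 0 < (2 * S.N + 1) ^ (d - 1) := by positivity
  nlinarith

/-- The volume of `K` is at most `(2N)^{d+1}`. [folklore] -/
theorem volume_K_le : (volume S.K).toReal ≤ (2 * (S.N : ℝ)) ^ (d + 1) := by
  have hvol : (volume (realBox (d + 1) (S.N : ℝ))).toReal = (2 * (S.N : ℝ)) ^ (d + 1) := by
    unfold realBox
    rw [Real.volume_Icc_pi_toReal (fun _ => by
      have : (0 : ℝ) ≤ S.N := Nat.cast_nonneg _
      linarith)]
    simp only [Finset.prod_const, Finset.card_univ, Fintype.card_fin]
    ring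
  rw [← hvol]
  exact ENNReal.toReal_mono (by unfold realBox; exact isCompact_Icc.measure_lt_top.ne) (measure_mono S.subset)

end FibreSetting

end Summit.Parity.GeneralizedHardyLittlewood.Theorems
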